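import Summits.QuantumFields.YangMills.Theorems.ColdStartUniversalityLatticeLangevinPoissonEquation
import HarnessLib

/-!
# Route `ColdStartUniversality` (fixed-cut-off `L²(μ_{β'})` package): the INTEGRATED AUTOCORRELATION TIME of the reversible SZZ
# dynamics — `Var_μ(F)/𝓔(F) ≤ ∫₀^∞ ⟨F, P_t F⟩_μ dt / Var_μ(F) ≤ 1/c`

Helper file (seat `ym-line-csu-p1`, g16), sequel of `…WilsonSpectralGap` (gap `⟨F,P_tF⟩ ≤ e^{-ct}‖F‖²`, centred `F`),
`…AutocorrelationLowerBound` (g15: `‖F‖² e^{-t𝓔(F)/‖F‖²} ≤ ⟨F,P_tF⟩`) and `…PoissonEquation` (corrector `u = ∫₀^∞ P_tF dt`).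
For the SU(2) lattice Langevin dynamics at any `β'`, `μ = μ_{β'}`, continuous centred `F`, `φ_F(t) = ∫ F·κ_tF dμ`:

* `abs_integral_mul_transition_le` — CROSS-correlations: `|∫ G·κ_tF dμ| ≤ e^{-ct} ‖F‖_μ ‖G‖_μ` (centred continuous `F, G`);
* `integrableOn_autocorrelation` — `φ_F` is integrable on `(0,∞)`;
* ★ `integral_autocorrelation_le` — `∫_{(0,∞)} φ_F ≤ ‖F‖²_μ / c`: the integrated autocorrelation time `τ_int(F) := ∫₀^∞ φ_F/‖F‖²`
  is at most `1/c` (`c = c(L,β')` the Doeblin = `L²` rate);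
* ★ `integral_autocorrelation_ge` — for a smooth cylinder centred `F = f∘coords` with `𝓔(F) = −⟨F, 𝓛f⟩_μ > 0`:
  `‖F‖⁴_μ/𝓔(F) ≤ ∫_{(0,∞)} φ_F`, i.e. `τ_int(F) ≥ Var_μ(F)/𝓔(F)` (integrate g15's variational lower bound);
* `integral_autocorrelation_eq_integral_mul_corrector` — `∫_{(0,∞)} φ_F = ⟨F, u⟩_μ` for the corrector `u` of
  `exists_poisson_solution` (Fubini): the Kipnis–Varadhan asymptotic variance `σ²(F) = 2⟨F, (−𝓛)⁻¹F⟩ = 2∫₀^∞ φ_F`.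

Reading: `τ_int` is the quantity the instrument rows measure (MCMC error bars); at each fixed cut-off it is sandwiched between the
variational time `Var/𝓔` of the observable and the inverse Doeblin rate.  THEOREMS ONLY, no definition, no sorry.  HONEST FRAMING:
fixed-cut-off plumbing, nothing uniform in the cut-off; no rung, crux or summit statement is proved; the Yang–Mills mass gap is NOT proved.
-/

set_option autoImplicit false

noncomputable section

namespace Summit.QuantumFields.YangMills.Theorems.ColdStartUniversality

open MeasureTheory ProbabilityTheory Finset Filter Set Topology
open scoped BigOperators NNReal ENNReal
open Literature.Probability.Process Literature.MathematicalPhysics.QuantumFieldTheory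
open Literature.MathematicalPhysics.QuantumLattice (fundamentalRep fundamentalLatticeRep continuous_fundamentalRep)

variable {L : ℕ} [NeZero L]

/-! ## Cross-correlations -/

/-- **Exponential decay of stationary cross-correlations**: with the `L²` rate of `wilson_spectralGap`, for every realising kernel
family and centred continuous `F, G`: `|∫ G · κ_t F dμ_{β'}| ≤ e^{-ct} ‖F‖_{L²(μ)} ‖G‖_{L²(μ)}` (Cauchy–Schwarz and
`‖κ_tF‖ ≤ e^{-ct}‖F‖`). [cite: RobertsRosenthal1997, Theorem 2.1] -/
theorem abs_integral_mul_transition_le (L : ℕ) [NeZero L] (β' : ℝ) :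
    ∃ c : ℝ, 0 < c ∧
      ∀ (κ : ℝ≥0 → Kernel (GaugeConfig 3 L (Matrix.specialUnitaryGroup (Fin 2) ℂ))
          (GaugeConfig 3 L (Matrix.specialUnitaryGroup (Fin 2) ℂ))) [∀ t, IsMarkovKernel (κ t)],
        (∀ (t : ℝ≥0) (x : GaugeConfig 3 L (Matrix.specialUnitaryGroup (Fin 2) ℂ))
          (Ω : Type) [MeasurableSpace Ω] (P : Measure Ω) [IsProbabilityMeasure P]
          (W : ℝ≥0 → Ω → (Edge 3 L × NoiseIdx 2 → ℝ)) (hW : IsFlatBrownian W P)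
          (U : ℝ≥0 → Ω → GaugeConfig 3 L (Matrix.specialUnitaryGroup (Fin 2) ℂ)),
          (∀ ω, U 0 ω = x) →
          (latticeLangevinDynamics (fundamentalLatticeRep 2) β').IsSolution (fundamentalRep (Fin 2))
            hW.natFiltration P W U →
          κ t x = P.map (U t)) →
        (∀ (F : GaugeConfig 3 L (Matrix.specialUnitaryGroup (Fin 2) ℂ) → ℝ), Continuous F →
          ∫ x, F x ∂(wilsonMeasure (d := 3) (L := L) (fundamentalRep (Fin 2)) β') = 0 → ∀ t : ℝ≥0,
            ∫ x, F x * (∫ y, F y ∂(κ t x)) ∂(wilsonMeasure (d := 3) (L := L) (fundamentalRep (Fin 2)) β') ≤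
              Real.exp (-c * t) * ∫ x, F x * F x ∂(wilsonMeasure (d := 3) (L := L) (fundamentalRep (Fin 2)) β')) ∧
        ∀ (F G : GaugeConfig 3 L (Matrix.specialUnitaryGroup (Fin 2) ℂ) → ℝ), Continuous F → Continuous G →
          ∫ x, F x ∂(wilsonMeasure (d := 3) (L := L) (fundamentalRep (Fin 2)) β') = 0 →
          ∫ x, G x ∂(wilsonMeasure (d := 3) (L := L) (fundamentalRep (Fin 2)) β') = 0 → ∀ t : ℝ≥0,
            |∫ x, G x * (∫ y, F y ∂(κ t x)) ∂(wilsonMeasure (d := 3) (L := L) (fundamentalRep (Fin 2)) β')| ≤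
              Real.exp (-c * t) * Real.sqrt (∫ x, F x * F x ∂(wilsonMeasure (d := 3) (L := L) (fundamentalRep (Fin 2)) β')) *
                Real.sqrt (∫ x, G x * G x ∂(wilsonMeasure (d := 3) (L := L) (fundamentalRep (Fin 2)) β')) := by
  classical
  haveI := secondCountableTopology_su2
  haveI := borelSpace_config L
  haveI : IsProbabilityMeasure (wilsonMeasure (d := 3) (L := L) (fundamentalRep (Fin 2)) β') :=
    isProbabilityMeasure_wilsonMeasure (d := 3) (L := L) (fundamentalRep (Fin 2)) (continuous_fundamentalRep (Fin 2)) β'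
  obtain ⟨c, hc, hgap⟩ := wilson_spectralGap L β'
  refine ⟨c, hc, fun κ _ hreal => ⟨fun F hF hF0 t => (hgap κ hreal F hF t).1 hF0, fun F G hF hG hF0 hG0 t => ?_⟩⟩
  set μ : Measure (GaugeConfig 3 L (Matrix.specialUnitaryGroup (Fin 2) ℂ)) :=
    wilsonMeasure (d := 3) (L := L) (fundamentalRep (Fin 2)) β' with hμ
  obtain ⟨MF, -, hMF⟩ := exists_abs_le_of_continuous hF
  obtain ⟨MG, -, hMG⟩ := exists_abs_le_of_continuous hG
  have hκF : Continuous fun x => ∫ y, F y ∂(κ t x) := continuous_integral_transitionKernel L β' κ hreal t hF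
  have hκFb : ∀ x, |∫ y, F y ∂(κ t x)| ≤ MF := fun x => abs_integral_le_of_abs_le_of_isProbabilityMeasure hMF
  have hCS := sq_integral_mul_le_integral_sq_mul μ hG.measurable hκF.measurable hMG hκFb
  have hL2 := (hgap κ hreal F hF t).2.1 hF0
  set A : ℝ := ∫ x, F x * F x ∂μ with hA
  set B : ℝ := ∫ x, G x * G x ∂μ with hB
  have hA0 : 0 ≤ A := integral_nonneg fun x => mul_self_nonneg _
  have hB0 : 0 ≤ B := integral_nonneg fun x => mul_self_nonneg _
  have hB' : ∫ x, (G x) ^ 2 ∂μ = B := integral_congr_ae (Eventually.of_forall fun x => by simp [sq])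
  rw [hB'] at hCS
  have h2 : (∫ x, G x * (∫ y, F y ∂(κ t x)) ∂μ) ^ 2 ≤ (Real.exp (-c * t)) ^ 2 * A * B := by
    calc (∫ x, G x * (∫ y, F y ∂(κ t x)) ∂μ) ^ 2 ≤ B * ∫ x, (∫ y, F y ∂(κ t x)) ^ 2 ∂μ := hCS
      _ ≤ B * (Real.exp (-2 * c * t) * A) := mul_le_mul_of_nonneg_left hL2 hB0
      _ = (Real.exp (-c * t)) ^ 2 * A * B := by
          rw [← Real.exp_nat_mul]; push_cast; ring_nf
  have hrhs : 0 ≤ Real.exp (-c * t) * Real.sqrt A * Real.sqrt B := by positivity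
  rw [← Real.sqrt_sq hrhs]
  refine Real.abs_le_sqrt ?_
  rw [mul_pow, mul_pow, Real.sq_sqrt hA0, Real.sq_sqrt hB0]
  exact h2

/-! ## The integrated autocorrelation time: upper bound `1/c` -/

/-- ★ **`∫₀^∞ ⟨F, P_tF⟩_μ dt ≤ ‖F‖²_μ / c`** for centred continuous `F` (and the autocorrelation function is integrable on
`(0,∞)`): the integrated autocorrelation time is at most the inverse Doeblin/`L²` rate.  Also `0 ≤ ∫₀^∞ ⟨F,P_tF⟩ dt`
(`⟨F, P_tF⟩ = ‖P_{t/2}F‖² ≥ 0`). [cite: RobertsRosenthal1997, Theorem 2.1] -/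
theorem integral_autocorrelation_le (L : ℕ) [NeZero L] (β' : ℝ) :
    ∃ c : ℝ, 0 < c ∧
      ∀ (κ : ℝ≥0 → Kernel (GaugeConfig 3 L (Matrix.specialUnitaryGroup (Fin 2) ℂ))
          (GaugeConfig 3 L (Matrix.specialUnitaryGroup (Fin 2) ℂ))) [∀ t, IsMarkovKernel (κ t)],
        (∀ (t : ℝ≥0) (x : GaugeConfig 3 L (Matrix.specialUnitaryGroup (Fin 2) ℂ))
          (Ω : Type) [MeasurableSpace Ω] (P : Measure Ω) [IsProbabilityMeasure P]
          (W : ℝ≥0 → Ω → (Edge 3 L × NoiseIdx 2 → ℝ)) (hW : IsFlatBrownian W P)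
          (U : ℝ≥0 → Ω → GaugeConfig 3 L (Matrix.specialUnitaryGroup (Fin 2) ℂ)),
          (∀ ω, U 0 ω = x) →
          (latticeLangevinDynamics (fundamentalLatticeRep 2) β').IsSolution (fundamentalRep (Fin 2))
            hW.natFiltration P W U →
          κ t x = P.map (U t)) →
        ∀ (F : GaugeConfig 3 L (Matrix.specialUnitaryGroup (Fin 2) ℂ) → ℝ), Continuous F →
          ∫ x, F x ∂(wilsonMeasure (d := 3) (L := L) (fundamentalRep (Fin 2)) β') = 0 →
          IntegrableOn (fun t : ℝ => ∫ x, F x * (∫ y, F y ∂(κ t.toNNReal x))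
            ∂(wilsonMeasure (d := 3) (L := L) (fundamentalRep (Fin 2)) β')) (Ioi (0 : ℝ)) ∧
          0 ≤ ∫ t in Ioi (0 : ℝ), (∫ x, F x * (∫ y, F y ∂(κ t.toNNReal x))
            ∂(wilsonMeasure (d := 3) (L := L) (fundamentalRep (Fin 2)) β')) ∧
          ∫ t in Ioi (0 : ℝ), (∫ x, F x * (∫ y, F y ∂(κ t.toNNReal x))
              ∂(wilsonMeasure (d := 3) (L := L) (fundamentalRep (Fin 2)) β')) ≤
            (∫ x, F x * F x ∂(wilsonMeasure (d := 3) (L := L) (fundamentalRep (Fin 2)) β')) / c := by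
  classical
  haveI := secondCountableTopology_su2
  haveI := borelSpace_config L
  haveI : IsProbabilityMeasure (wilsonMeasure (d := 3) (L := L) (fundamentalRep (Fin 2)) β') :=
    isProbabilityMeasure_wilsonMeasure (d := 3) (L := L) (fundamentalRep (Fin 2)) (continuous_fundamentalRep (Fin 2)) β'
  obtain ⟨c, hc, hgap⟩ := wilson_spectralGap L β'
  refine ⟨c, hc, fun κ _ hreal F hF hF0 => ?_⟩
  set μ : Measure (GaugeConfig 3 L (Matrix.specialUnitaryGroup (Fin 2) ℂ)) :=
    wilsonMeasure (d := 3) (L := L) (fundamentalRep (Fin 2)) β' with hμ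
  set A : ℝ := ∫ x, F x * F x ∂μ with hA
  have hA0 : 0 ≤ A := integral_nonneg fun x => mul_self_nonneg _
  set φ : ℝ → ℝ := fun t => ∫ x, F x * (∫ y, F y ∂(κ t.toNNReal x)) ∂μ with hφ
  -- continuity of `φ` (joint continuity of the kernel action)
  have hJ : Continuous (Function.uncurry fun (t : ℝ) (x : GaugeConfig 3 L (Matrix.specialUnitaryGroup (Fin 2) ℂ)) =>
      F x * ∫ y, F y ∂(κ t.toNNReal x)) :=
    (hF.comp continuous_snd).mul ((continuous_transitionKernel_action β' κ hreal hF).comp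
      ((continuous_real_toNNReal.comp continuous_fst).prodMk continuous_snd))
  have hφc : Continuous φ := continuous_integral_of_continuous_uncurry μ hJ
  -- the pointwise bounds `0 ≤ φ t ≤ e^{-ct} A` on `(0, ∞)`
  have hφnn : ∀ t, 0 ≤ φ t := fun t => integral_mul_transition_self_nonneg L β' κ hreal t.toNNReal hF
  have hφle : ∀ t : ℝ, 0 ≤ t → φ t ≤ Real.exp (-c * t) * A := by
    intro t ht
    have h := (hgap κ hreal F hF t.toNNReal).1 hF0
    rwa [Real.coe_toNNReal t ht] at h
  set b : ℝ → ℝ := fun t => Real.exp (-c * t) * A with hb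
  have hbi : IntegrableOn b (Ioi (0 : ℝ)) := (exp_neg_integrableOn_Ioi 0 hc).mul_const A
  have hφi : IntegrableOn φ (Ioi (0 : ℝ)) := by
    refine Integrable.mono' hbi hφc.aestronglyMeasurable ?_
    filter_upwards [ae_restrict_mem measurableSet_Ioi] with t ht
    rw [Real.norm_eq_abs, abs_of_nonneg (hφnn t)]
    exact hφle t (le_of_lt ht)
  have hbint : ∫ t in Ioi (0 : ℝ), b t = A / c := by
    rw [hb]
    simp only [integral_mul_const]
    rw [integral_exp_mul_Ioi (by linarith : -c < 0) 0]
    simp only [mul_zero, Real.exp_zero]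
    field_simp
  refine ⟨hφi, setIntegral_nonneg measurableSet_Ioi fun t _ => hφnn t, ?_⟩
  rw [← hbint]
  exact setIntegral_mono_on hφi hbi measurableSet_Ioi fun t ht => hφle t (le_of_lt ht)

/-! ## The integrated autocorrelation time: lower bound `Var/𝓔` -/

/-- ★ **`‖F‖⁴_μ / 𝓔(F) ≤ ∫₀^∞ ⟨F, P_tF⟩_μ dt`** for a smooth cylinder centred `F = f∘coords` (`f` `C³` with compact support) with
`𝓔(F) = −∫ F·𝓛f dμ_{β'} > 0`: integrate g15's variational lower bound `‖F‖² e^{-t𝓔(F)/‖F‖²} ≤ ⟨F,P_tF⟩` over `(0,∞)`.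
Reading: `τ_int(F) ≥ Var_μ(F)/𝓔(F)`. [cite: ShenZhuZhu2022, §3 (Dirichlet form 𝓔^L, p. 13)] -/
theorem integral_autocorrelation_ge (L : ℕ) [NeZero L] (β' : ℝ)
    (κ : ℝ≥0 → Kernel (GaugeConfig 3 L (Matrix.specialUnitaryGroup (Fin 2) ℂ))
      (GaugeConfig 3 L (Matrix.specialUnitaryGroup (Fin 2) ℂ))) [∀ t, IsMarkovKernel (κ t)]
    (hreal : ∀ (t : ℝ≥0) (x : GaugeConfig 3 L (Matrix.specialUnitaryGroup (Fin 2) ℂ))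
        (Ω : Type) [MeasurableSpace Ω] (P : Measure Ω) [IsProbabilityMeasure P]
        (W : ℝ≥0 → Ω → (Edge 3 L × NoiseIdx 2 → ℝ)) (hW : IsFlatBrownian W P)
        (U : ℝ≥0 → Ω → GaugeConfig 3 L (Matrix.specialUnitaryGroup (Fin 2) ℂ)),
        (∀ ω, U 0 ω = x) →
        (latticeLangevinDynamics (fundamentalLatticeRep 2) β').IsSolution (fundamentalRep (Fin 2))
          hW.natFiltration P W U →
        κ t x = P.map (U t))
    {f : (Edge 3 L × Fin 2 × Fin 2 × Bool → ℝ) → ℝ} (hf : ContDiff ℝ 3 f) (hfc : HasCompactSupport f)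
    (hint : IntegrableOn (fun t : ℝ => ∫ V, f (fun q : Edge 3 L × Fin 2 × Fin 2 × Bool =>
        (fun z : ℂ => if q.2.2.2 then z.im else z.re) ((fundamentalRep (Fin 2) (V q.1) : Matrix (Fin 2) (Fin 2) ℂ) q.2.1 q.2.2.1)) *
        (∫ y, f (fun q : Edge 3 L × Fin 2 × Fin 2 × Bool => (fun z : ℂ => if q.2.2.2 then z.im else z.re)
          ((fundamentalRep (Fin 2) (y q.1) : Matrix (Fin 2) (Fin 2) ℂ) q.2.1 q.2.2.1)) ∂(κ t.toNNReal V))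
        ∂(wilsonMeasure (d := 3) (L := L) (fundamentalRep (Fin 2)) β')) (Ioi (0 : ℝ)))
    (hE : 0 < -∫ V, f (fun q : Edge 3 L × Fin 2 × Fin 2 × Bool => (fun z : ℂ => if q.2.2.2 then z.im else z.re)
        ((fundamentalRep (Fin 2) (V q.1) : Matrix (Fin 2) (Fin 2) ℂ) q.2.1 q.2.2.1)) *
      ((∑ i : Edge 3 L × Fin 2 × Fin 2 × Bool, fderiv ℝ f (fun q : Edge 3 L × Fin 2 × Fin 2 × Bool =>
          (fun z : ℂ => if q.2.2.2 then z.im else z.re) ((fundamentalRep (Fin 2) (V q.1) : Matrix (Fin 2) (Fin 2) ℂ) q.2.1 q.2.2.1))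
          (Pi.single i 1) *
          (fun z : ℂ => if i.2.2.2 then z.im else z.re)
            ((latticeLangevinDynamics (fundamentalLatticeRep 2) β').drift
              (matrixConfig (fundamentalRep (Fin 2)) V) i.1 i.2.1 i.2.2.1) +
      1 / 2 * ∑ i : Edge 3 L × Fin 2 × Fin 2 × Bool, ∑ j : Edge 3 L × Fin 2 × Fin 2 × Bool,
        fderiv ℝ (fun z => fderiv ℝ f z (Pi.single i 1)) (fun q : Edge 3 L × Fin 2 × Fin 2 × Bool =>
          (fun z : ℂ => if q.2.2.2 then z.im else z.re) ((fundamentalRep (Fin 2) (V q.1) : Matrix (Fin 2) (Fin 2) ℂ) q.2.1 q.2.2.1))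
          (Pi.single j 1) *
          ∑ n : Edge 3 L × NoiseIdx 2,
            (if n.1 = i.1 then (fun z : ℂ => if i.2.2.2 then z.im else z.re)
              ((latticeLangevinDynamics (fundamentalLatticeRep 2) β').noise
                (matrixConfig (fundamentalRep (Fin 2)) V) i.1 n.2 i.2.1 i.2.2.1) else 0) *
            (if n.1 = j.1 then (fun z : ℂ => if j.2.2.2 then z.im else z.re)
              ((latticeLangevinDynamics (fundamentalLatticeRep 2) β').noise
                (matrixConfig (fundamentalRep (Fin 2)) V) j.1 n.2 j.2.1 j.2.2.1) else 0)))
      ∂(wilsonMeasure (d := 3) (L := L) (fundamentalRep (Fin 2)) β')) :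
    let coords : GaugeConfig 3 L (Matrix.specialUnitaryGroup (Fin 2) ℂ) → (Edge 3 L × Fin 2 × Fin 2 × Bool → ℝ) :=
      fun V q => (fun z : ℂ => if q.2.2.2 then z.im else z.re)
        ((fundamentalRep (Fin 2) (V q.1) : Matrix (Fin 2) (Fin 2) ℂ) q.2.1 q.2.2.1)
    let gen : GaugeConfig 3 L (Matrix.specialUnitaryGroup (Fin 2) ℂ) → ℝ := fun V =>
      (∑ i : Edge 3 L × Fin 2 × Fin 2 × Bool, fderiv ℝ f (coords V) (Pi.single i 1) *
          (fun z : ℂ => if i.2.2.2 then z.im else z.re)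
            ((latticeLangevinDynamics (fundamentalLatticeRep 2) β').drift
              (matrixConfig (fundamentalRep (Fin 2)) V) i.1 i.2.1 i.2.2.1) +
      1 / 2 * ∑ i : Edge 3 L × Fin 2 × Fin 2 × Bool, ∑ j : Edge 3 L × Fin 2 × Fin 2 × Bool,
        fderiv ℝ (fun z => fderiv ℝ f z (Pi.single i 1)) (coords V) (Pi.single j 1) *
          ∑ n : Edge 3 L × NoiseIdx 2,
            (if n.1 = i.1 then (fun z : ℂ => if i.2.2.2 then z.im else z.re)
              ((latticeLangevinDynamics (fundamentalLatticeRep 2) β').noise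
                (matrixConfig (fundamentalRep (Fin 2)) V) i.1 n.2 i.2.1 i.2.2.1) else 0) *
            (if n.1 = j.1 then (fun z : ℂ => if j.2.2.2 then z.im else z.re)
              ((latticeLangevinDynamics (fundamentalLatticeRep 2) β').noise
                (matrixConfig (fundamentalRep (Fin 2)) V) j.1 n.2 j.2.1 j.2.2.1) else 0))
    let F' : GaugeConfig 3 L (Matrix.specialUnitaryGroup (Fin 2) ℂ) → ℝ := fun V => f (coords V)
    (∫ V, F' V * F' V ∂(wilsonMeasure (d := 3) (L := L) (fundamentalRep (Fin 2)) β')) ^ 2 /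
        (-∫ V, F' V * gen V ∂(wilsonMeasure (d := 3) (L := L) (fundamentalRep (Fin 2)) β')) ≤
      ∫ t in Ioi (0 : ℝ), (∫ V, F' V * (∫ y, F' y ∂(κ t.toNNReal V))
        ∂(wilsonMeasure (d := 3) (L := L) (fundamentalRep (Fin 2)) β')) := by
  intro coords gen F'
  classical
  haveI := secondCountableTopology_su2
  haveI := borelSpace_config L
  set μ : Measure (GaugeConfig 3 L (Matrix.specialUnitaryGroup (Fin 2) ℂ)) :=
    wilsonMeasure (d := 3) (L := L) (fundamentalRep (Fin 2)) β' with hμ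
  haveI : IsProbabilityMeasure μ :=
    isProbabilityMeasure_wilsonMeasure (d := 3) (L := L) (fundamentalRep (Fin 2)) (continuous_fundamentalRep (Fin 2)) β'
  set φ₀ : ℝ := ∫ V, F' V * F' V ∂μ with hφ₀
  set d : ℝ := ∫ V, F' V * gen V ∂μ with hd
  set φ : ℝ → ℝ := fun t => ∫ V, F' V * (∫ y, F' y ∂(κ t.toNNReal V)) ∂μ with hφ
  have hdneg : d < 0 := by linarith
  have hφ₀nn : 0 ≤ φ₀ := integral_nonneg fun V => mul_self_nonneg _
  rcases hφ₀nn.eq_or_lt with hz | hpos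
  · -- `‖F‖² = 0`: the left side vanishes
    show φ₀ ^ 2 / (-d) ≤ ∫ t in Ioi (0 : ℝ), φ t
    rw [← hz]
    simp only [ne_eq, OfNat.ofNat_ne_zero, not_false_eq_true, zero_pow, zero_div]
    exact setIntegral_nonneg measurableSet_Ioi fun t _ => integral_mul_transition_self_nonneg L β' κ hreal t.toNNReal
      (hf.continuous.comp (continuous_coords (L := L)))
  -- `‖F‖² > 0`: integrate the variational lower bound `φ₀ e^{t d/φ₀} ≤ φ t`
  set a : ℝ := -d / φ₀ with ha
  have hapos : 0 < a := div_pos (by linarith) hpos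
  have hlow : ∀ t : ℝ, 0 ≤ t → φ₀ * Real.exp (-a * t) ≤ φ t := by
    intro t ht
    have h := integral_sq_mul_exp_le_integral_mul_transition L β' κ hreal hf hfc hpos t.toNNReal
    have e : ((t.toNNReal : ℝ≥0) : ℝ) * d / φ₀ = -a * t := by
      rw [Real.coe_toNNReal t ht, ha]; ring
    simp only [] at h
    rw [e] at h
    exact h
  have hℓi : IntegrableOn (fun t : ℝ => φ₀ * Real.exp (-a * t)) (Ioi (0 : ℝ)) :=
    (exp_neg_integrableOn_Ioi 0 hapos).const_mul φ₀
  have hℓint : ∫ t in Ioi (0 : ℝ), φ₀ * Real.exp (-a * t) = φ₀ ^ 2 / (-d) := by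
    simp only [integral_const_mul]
    rw [integral_exp_mul_Ioi (by linarith : -a < 0) 0]
    simp only [mul_zero, Real.exp_zero]
    rw [ha]
    field_simp
  show φ₀ ^ 2 / (-d) ≤ ∫ t in Ioi (0 : ℝ), φ t
  rw [← hℓint]
  exact setIntegral_mono_on hℓi hint measurableSet_Ioi fun t ht => hlow t (le_of_lt ht)

/-! ## The Kipnis–Varadhan identity `∫₀^∞ ⟨F, P_tF⟩ dt = ⟨F, u⟩` -/

/-- **`∫₀^∞ ⟨F, P_tF⟩_μ dt = ⟨F, u⟩_μ`** for a centred continuous `F` and any `u` with `u(x) = ∫_{(0,∞)} κ_t F(x) dt` (the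
corrector of `exists_poisson_solution`): Fubini on `μ × (0,∞)`, the integrand being bounded by `‖F‖_∞² C e^{-ct}`
(`exp_mixing_transitionKernel`).  Twice this is the Kipnis–Varadhan asymptotic variance `2⟨F, (−𝓛)⁻¹F⟩_μ`.
[cite: RobertsRosenthal1997, Theorem 2.1] -/
theorem integral_autocorrelation_eq_integral_mul_corrector (L : ℕ) [NeZero L] (β' : ℝ)
    (κ : ℝ≥0 → Kernel (GaugeConfig 3 L (Matrix.specialUnitaryGroup (Fin 2) ℂ))
      (GaugeConfig 3 L (Matrix.specialUnitaryGroup (Fin 2) ℂ))) [∀ t, IsMarkovKernel (κ t)]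
    (hreal : ∀ (t : ℝ≥0) (x : GaugeConfig 3 L (Matrix.specialUnitaryGroup (Fin 2) ℂ))
        (Ω : Type) [MeasurableSpace Ω] (P : Measure Ω) [IsProbabilityMeasure P]
        (W : ℝ≥0 → Ω → (Edge 3 L × NoiseIdx 2 → ℝ)) (hW : IsFlatBrownian W P)
        (U : ℝ≥0 → Ω → GaugeConfig 3 L (Matrix.specialUnitaryGroup (Fin 2) ℂ)),
        (∀ ω, U 0 ω = x) →
        (latticeLangevinDynamics (fundamentalLatticeRep 2) β').IsSolution (fundamentalRep (Fin 2))
          hW.natFiltration P W U →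
        κ t x = P.map (U t))
    {F u : GaugeConfig 3 L (Matrix.specialUnitaryGroup (Fin 2) ℂ) → ℝ} (hF : Continuous F)
    (hF0 : ∫ x, F x ∂(wilsonMeasure (d := 3) (L := L) (fundamentalRep (Fin 2)) β') = 0)
    (hu : ∀ x, u x = ∫ t in Ioi (0 : ℝ), (∫ y, F y ∂(κ t.toNNReal x))) :
    ∫ t in Ioi (0 : ℝ), (∫ x, F x * (∫ y, F y ∂(κ t.toNNReal x)) ∂(wilsonMeasure (d := 3) (L := L) (fundamentalRep (Fin 2)) β')) =
      ∫ x, F x * u x ∂(wilsonMeasure (d := 3) (L := L) (fundamentalRep (Fin 2)) β') := by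
  classical
  haveI := secondCountableTopology_su2
  haveI := borelSpace_config L
  set μ : Measure (GaugeConfig 3 L (Matrix.specialUnitaryGroup (Fin 2) ℂ)) :=
    wilsonMeasure (d := 3) (L := L) (fundamentalRep (Fin 2)) β' with hμ
  haveI : IsProbabilityMeasure μ :=
    isProbabilityMeasure_wilsonMeasure (d := 3) (L := L) (fundamentalRep (Fin 2)) (continuous_fundamentalRep (Fin 2)) β'
  obtain ⟨C, c, hC, hc, hmix⟩ := exp_mixing_transitionKernel L β'
  obtain ⟨M, hM0, hM⟩ := exists_abs_le_of_continuous hF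
  -- the integrand and its bound `|F(x) κ_tF(x)| ≤ M · M C e^{-ct}` on `(0,∞)`
  set g : ℝ → GaugeConfig 3 L (Matrix.specialUnitaryGroup (Fin 2) ℂ) → ℝ := fun t x => ∫ y, F y ∂(κ t.toNNReal x) with hg
  have hJ : Continuous (Function.uncurry fun (x : GaugeConfig 3 L (Matrix.specialUnitaryGroup (Fin 2) ℂ)) (t : ℝ) =>
      F x * g t x) :=
    (hF.comp continuous_fst).mul (((continuous_transitionKernel_action β' κ hreal hF).comp
      ((continuous_real_toNNReal.comp continuous_fst).prodMk continuous_snd)).comp continuous_swap)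
  have hgb : ∀ t x, |g t x| ≤ M * (C * Real.exp (-c * (t.toNNReal : ℝ))) := by
    intro t x
    have h := hmix κ hreal x t.toNNReal F hF.measurable M hM
    rwa [hF0, sub_zero] at h
  set b : ℝ → ℝ := fun t => M * (M * C) * Real.exp (-c * t) with hb
  have hbi : IntegrableOn b (Ioi (0 : ℝ)) := (exp_neg_integrableOn_Ioi 0 hc).const_mul (M * (M * C))
  have hint : Integrable (Function.uncurry fun (x : GaugeConfig 3 L (Matrix.specialUnitaryGroup (Fin 2) ℂ)) (t : ℝ) =>
      F x * g t x) (μ.prod (volume.restrict (Ioi (0 : ℝ)))) := by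
    have hB : Integrable (fun p : GaugeConfig 3 L (Matrix.specialUnitaryGroup (Fin 2) ℂ) × ℝ => (1 : ℝ) * b p.2)
        (μ.prod (volume.restrict (Ioi (0 : ℝ)))) := (integrable_const (1 : ℝ)).mul_prod hbi
    refine Integrable.mono' hB hJ.aestronglyMeasurable ?_
    have hs : MeasurableSet {p : GaugeConfig 3 L (Matrix.specialUnitaryGroup (Fin 2) ℂ) × ℝ | p.2 ∈ Ioi (0 : ℝ)} :=
      measurableSet_Ioi.preimage measurable_snd
    have hae : ∀ᵐ p ∂(μ.prod (volume.restrict (Ioi (0 : ℝ)))),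
        p ∈ {p : GaugeConfig 3 L (Matrix.specialUnitaryGroup (Fin 2) ℂ) × ℝ | p.2 ∈ Ioi (0 : ℝ)} := by
      rw [Measure.ae_prod_mem_iff_ae_ae_mem hs]
      exact Eventually.of_forall fun y => ae_restrict_mem measurableSet_Ioi
    filter_upwards [hae] with p hp
    have hp' : (0 : ℝ) < p.2 := hp
    rw [Real.norm_eq_abs, one_mul, hb]
    have h := hgb p.2 p.1
    rw [Real.coe_toNNReal p.2 hp'.le] at h
    show |F p.1 * g p.2 p.1| ≤ M * (M * C) * Real.exp (-c * p.2)
    rw [abs_mul]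
    calc |F p.1| * |g p.2 p.1| ≤ M * (M * (C * Real.exp (-c * p.2))) := mul_le_mul (hM p.1) h (abs_nonneg _) hM0
      _ = M * (M * C) * Real.exp (-c * p.2) := by ring
  have hswap : ∫ x, (∫ t in Ioi (0 : ℝ), F x * g t x) ∂μ = ∫ t in Ioi (0 : ℝ), (∫ x, F x * g t x ∂μ) :=
    integral_integral_swap hint
  show ∫ t in Ioi (0 : ℝ), (∫ x, F x * g t x ∂μ) = ∫ x, F x * u x ∂μ
  rw [← hswap]
  refine integral_congr_ae (Eventually.of_forall fun x => ?_)
  show (∫ t in Ioi (0 : ℝ), F x * g t x) = F x * u x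
  rw [hu x, ← integral_const_mul]

end Summit.QuantumFields.YangMills.Theorems.ColdStartUniversality

end
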